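import Summits.Parity.GeneralizedHardyLittlewood.Theorems.VinogradovHeathBrownErrorTerm
import Summits.Parity.GeneralizedHardyLittlewood.Theses.HeathBrownPrimeAP3

/-! # HeathBrownPrimeAP3 (1/3) — the progression weight and F1, the main term: `mainTermLowerAP_holds :
MainTermLowerAP` (item stmt-Parity-19664 of `route-Parity-HeathBrownPrimeAP3`)

Ledger of record: tier A, ledger **FRONTIER**; no bearing on prime pairs / parity / GHL (tribunal J 2026-08-26).
With the AP weight `w(k) = f₃(N − k/2)·1[2 ∣ k]` (`apWeight c N`, Literature `CubicMinorantDefs`) in the third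
slot at scale `2N`, `T_{2N}(Λ, Λ, w) = ∑_π f₃(π) ∑_{n₁+n₂=2π} Λ(n₁)Λ(n₂)`: the Fourier facts `|ŵ(α)| = |f̂₃(−2α)|`,
`∫₀¹ |ŵ|⁴ = ∫₀¹ |f̂₃|⁴` (reflection + doubling, `integral_fourth_apWeight`), and the main term
`T_{2N}(g_B, g_B, w) ≥ c_M (log 2N)^{−2c} (2N)²` from the rough-pair lower bound E6 (Literature
`roughModelPairCountLower_holds`) at the even numbers `m = 2π ∈ (N, 3N/2]` and Heath-Brown's count as hypothesis. Uses the shared helpers of the sibling port `VinogradovHeathBrown{Readout,MainTerm,ErrorTerm}.lean`.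
Sources: [HeathBrownActa2001] (Theorem 1), [Nathanson1996] (§8), [GreenTao2006Restriction].

Theorems-side PORT of the cell evidence `pub/parity-ideate/parity-ideate-p2/evidence/LineEFG_tree.lean`
(KERNEL-PROVED there, farm rc 0, axioms std), re-namespaced into the route namespace (precedent
`Theorems/MaynardProductExactGlue.lean`) and re-based on the LANDED Literature modules `CubicMinorantDefs`
(p407241: the weights `vmWeight`, `gWeight`, `hbWeight`, `apWeight`, `ternarySum`, `expSumOf`),
`TernaryHolderCounting` (E5, p410251), `RoughModelPairCount` (E6, p410680), `RoughModelFourierApprox`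
(E2, p410505), `HeathBrownWeightFourthMoment` (E4b, p410644), whose public lemmas replace the evidence's local
copies. Notation: `T = ternarySum`, `Λ_N = vmWeight N`, `g_B = gWeight B N` (the `W`-rough model of level
`(log N)^B` on `[1, N]`), `f₃ = hbWeight c N` (Heath-Brown primes `x³+2y³` from the box
`X < x, y ≤ X(1+η)`, `X = (N/6)^{1/3}`, `η = (log X)^{-c}`, weight `N^{1/3} log`). Port prepared and
farm-checked by parity-ideate-p2 g5 (planner); filed by a prover seat. -/

noncomputable section

open scoped FourierTransform ArithmeticFunction
open Finset MeasureTheory Filter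

namespace Summit.Parity.GeneralizedHardyLittlewood.Theses.HeathBrownPrimeAP3

open Literature.NumberTheory.Sieve Literature.NumberTheory.Sieve.CubicPrimes
open Literature.NumberTheory.Sieve.CubicMinorant hiding RoughModelFourierApprox HBFourierFourthMoment
  roughModelFourierApprox_holds hbFourierFourthMoment_holds
open Literature.NumberTheory.Waring.HuaCubes
open Summit.Parity.GeneralizedHardyLittlewood.Theses.VinogradovHeathBrown hiding RoughModelFourierApprox
  HBFourierFourthMoment roughModelFourierApprox_holds hbFourierFourthMoment_holds Assembly assembly_holds closes
open scoped Topology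

/-! ## A helper shared with the sibling line -/

/-- `η² = (log X)^{−2c} ≥ (log N)^{−2c}` for `N > 6`, `c ≥ 0`. [this line] -/
theorem log_rpow_neg_le_hbEta_sq {c : ℝ} (hc : 0 ≤ c) {N : ℕ} (hN : 6 < N) :
    Real.log N ^ (-(2 * c)) ≤ hbEta c N ^ 2 := by
  obtain ⟨-, hLX, hLXle⟩ := hbX_facts hN
  have hsq : hbEta c N ^ 2 = Real.log (hbX N) ^ (-(2 * c)) := by
    unfold hbEta
    rw [← Real.rpow_natCast, ← Real.rpow_mul hLX.le]
    congr 1; push_cast; ring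
  rw [hsq]
  exact Real.rpow_le_rpow_of_nonpos hLX hLXle (by linarith)


/-! ## Analytic facts about the progression weight `apWeight` -/

section APanalytic

/-- Re-indexing the even `k ≤ 2N` by `m = N − k/2 ≤ N`. [folklore] -/
theorem sum_range_even_eq {M : Type*} [AddCommMonoid M] (N : ℕ) (G : ℕ → M) :
    ∑ k ∈ range (2 * N + 1), (if Even k then G k else 0) =
      ∑ m ∈ range (N + 1), G (2 * (N - m)) := by
  rw [← Finset.sum_filter]
  have hset : (range (2 * N + 1)).filter Even = (range (N + 1)).image (fun j => 2 * j) := by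
    ext k
    simp only [mem_filter, mem_range, mem_image]
    constructor
    · rintro ⟨hk, ⟨j, rfl⟩⟩
      exact ⟨j, by omega, by omega⟩
    · rintro ⟨j, hj, rfl⟩
      exact ⟨by omega, even_two_mul j⟩
  rw [hset, Finset.sum_image (fun j _ j' _ h => by simpa using h)]
  have h2 : ∀ j ∈ range (N + 1), G (2 * j) = (fun i => G (2 * (N - i))) (N + 1 - 1 - j) := by
    intro j hj
    rw [mem_range] at hj
    simp only
    congr 2
    omega
  rw [Finset.sum_congr rfl h2, Finset.sum_range_reflect (fun i => G (2 * (N - i))) (N + 1)]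

/-- The mass of the AP weight is the mass of `f₃`. [this line] -/
theorem sum_apWeight_eq (c : ℝ) (N : ℕ) :
    ∑ k ∈ range (2 * N + 1), apWeight c N k = ∑ m ∈ range (N + 1), hbWeight c N m := by
  unfold apWeight
  rw [sum_range_even_eq N (fun k => hbWeight c N (N - k / 2))]
  refine Finset.sum_congr rfl fun m hm => ?_
  rw [mem_range] at hm
  congr 1
  omega

/-- `ŵ(α) = e(2Nα) · f̂₃(−2α)` (as `expSumOf` at scale `N`). [this line] -/
theorem expSumOf_apWeight (c : ℝ) (N : ℕ) (α : ℝ) :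
    expSumOf (apWeight c N) (2 * N) α =
      (𝐞 ((2 * N : ℝ) * α) : ℂ) * expSumOf (hbWeight c N) N (-2 * α) := by
  unfold expSumOf
  have h1 : ∀ k ∈ range (2 * N + 1), ((apWeight c N k : ℝ) : ℂ) * (𝐞 ((k : ℝ) * α) : ℂ) =
      if Even k then ((hbWeight c N (N - k / 2) : ℝ) : ℂ) * (𝐞 ((k : ℝ) * α) : ℂ) else 0 := by
    intro k _
    unfold apWeight
    split_ifs <;> simp
  rw [Finset.sum_congr rfl h1,
    sum_range_even_eq N (fun k => ((hbWeight c N (N - k / 2) : ℝ) : ℂ) * (𝐞 ((k : ℝ) * α) : ℂ)),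
    Finset.mul_sum]
  refine Finset.sum_congr rfl fun m hm => ?_
  rw [mem_range] at hm
  have hsub : N - 2 * (N - m) / 2 = m := by omega
  simp only [hsub]
  have hchar : (𝐞 (((2 * (N - m) : ℕ) : ℝ) * α) : ℂ) =
      (𝐞 ((2 * N : ℝ) * α) : ℂ) * (𝐞 ((m : ℝ) * (-2 * α)) : ℂ) := by
    rw [← Circle.coe_mul, ← AddChar.map_add_eq_mul]
    congr 2
    rw [Nat.cast_mul, Nat.cast_sub (by omega : m ≤ N)]
    push_cast
    ring
  rw [hchar]
  ring

/-- `|ŵ(α)| = |f̂₃(−2α)|`. [this line] -/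
theorem norm_expSumOf_apWeight (c : ℝ) (N : ℕ) (α : ℝ) :
    ‖expSumOf (apWeight c N) (2 * N) α‖ = ‖hbExpSum c N (-2 * α)‖ := by
  rw [expSumOf_apWeight, norm_mul, Circle.norm_coe, one_mul, expSumOf_hbWeight]

/-- `1`-periodicity of `expSumOf`. [folklore] -/
theorem expSumOf_add_one (f : ℕ → ℝ) (N : ℕ) (β : ℝ) :
    expSumOf f N (β + 1) = expSumOf f N β := by
  unfold expSumOf
  refine Finset.sum_congr rfl fun n _ => ?_
  have h1 : (𝐞 ((n : ℝ)) : ℂ) = 1 := by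
    have h := RamanujanSum.fourierChar_intCast (n : ℤ)
    push_cast at h
    exact h
  rw [mul_add, mul_one, AddChar.map_add_eq_mul, Circle.coe_mul, h1, mul_one]

/-- **The `L⁴` identity** `∫₀¹ |ŵ(α)|⁴ dα = ∫₀¹ |f̂₃(α)|⁴ dα` (substitute `α ↦ −2α`, periodicity). [this line] -/
theorem integral_fourth_apWeight (c : ℝ) (N : ℕ) :
    ∫ α in (0 : ℝ)..1, ‖expSumOf (apWeight c N) (2 * N) α‖ ^ 4 =
      ∫ α in (0 : ℝ)..1, ‖hbExpSum c N α‖ ^ 4 := by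
  simp_rw [norm_expSumOf_apWeight, ← expSumOf_hbWeight]
  set G : ℝ → ℝ := fun β => ‖expSumOf (hbWeight c N) N β‖ ^ 4 with hG
  have hper : Function.Periodic G 1 := fun β => by
    simp only [hG, expSumOf_add_one]
  have hcont : Continuous G := (continuous_expSumOf _ _).norm.pow 4
  show ∫ α in (0 : ℝ)..1, G (-2 * α) = ∫ α in (0 : ℝ)..1, G α
  have h2 : (-2 : ℝ) * ∫ α in (0 : ℝ)..1, G (-2 * α) = ∫ α in (0 : ℝ)..(-2), G α := by
    have := intervalIntegral.smul_integral_comp_mul_left (f := G) (a := 0) (b := 1) (-2 : ℝ)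
    simpa using this
  have hsymm : ∫ α in (0 : ℝ)..(-2), G α = -∫ α in (-2 : ℝ)..0, G α :=
    intervalIntegral.integral_symm _ _
  have hsplit : (∫ α in (-2 : ℝ)..(-1), G α) + ∫ α in (-1 : ℝ)..0, G α =
      ∫ α in (-2 : ℝ)..0, G α :=
    intervalIntegral.integral_add_adjacent_intervals (hcont.intervalIntegrable _ _)
      (hcont.intervalIntegrable _ _)
  have hshift1 : ∫ α in (-2 : ℝ)..(-1), G α = ∫ α in (0 : ℝ)..1, G α := by
    have := hper.intervalIntegral_add_eq (-2) 0
    norm_num at this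
    exact this
  have hshift2 : ∫ α in (-1 : ℝ)..0, G α = ∫ α in (0 : ℝ)..1, G α := by
    have := hper.intervalIntegral_add_eq (-1) 0
    norm_num at this
    exact this
  linarith

end APanalytic

/-! ## F1 — the main term -/

section F1proof

/-- The mass of `f₃` from below: `∑_{m ≤ N} f₃(m) ≥ (κ/8) η² N` once Heath-Brown's lower bound holds at
`X = (N/6)^{1/3}`, `η ≤ 1/10` and `N > 6` (the Step 3 of Line E's A1, isolated). [this line] -/
theorem mass_ge {c κ : ℝ} (hκ : 0 < κ) {N : ℕ} (hN6 : 6 < N) (hη : hbEta c N ≤ 1 / 10)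
    (hPP : κ * (hbEta c N ^ 2 * hbX N ^ 2 / Real.log (hbX N)) ≤
      (primePairCount (hbX N) (hbEta c N) : ℝ)) :
    κ / 8 * hbEta c N ^ 2 * N ≤ ∑ n₃ ∈ range (N + 1), hbWeight c N n₃ := by
  obtain ⟨hX1, hLX, hLXle⟩ := hbX_facts hN6
  have hN0 : (0 : ℝ) < N := by exact_mod_cast (show 0 < N by omega)
  have hLN : 0 < Real.log N := Real.log_pos (by exact_mod_cast (show 1 < N by omega))
  have hcube : ((N : ℝ) ^ ((1 : ℝ) / 3)) ^ 3 = N := by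
    rw [← Real.rpow_natCast, ← Real.rpow_mul hN0.le]; norm_num
  have h1 : ∑ n₃ ∈ range (N + 1), (N : ℝ) ^ ((1 : ℝ) / 3) * (Real.log N / 2) * (hbRep c N n₃ : ℝ) ≤
      ∑ n₃ ∈ range (N + 1), hbWeight c N n₃ := by
    refine Finset.sum_le_sum fun n₃ _ => ?_
    by_cases hr : hbRep c N n₃ = 0
    · simp [hbWeight, hr]
    · unfold hbWeight
      refine mul_le_mul_of_nonneg_right (mul_le_mul_of_nonneg_left ?_ (by positivity))
        (Nat.cast_nonneg _)
      obtain ⟨x, y, -, -, -, -, hlt⟩ := exists_of_hbRep_ne_zero hr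
      have hn₃ : (N : ℝ) / 2 ≤ n₃ := by
        have : (N : ℝ) < 2 * n₃ := by exact_mod_cast hlt
        linarith
      have hlog2 : Real.log ((N : ℝ) / 2) = Real.log N - Real.log 2 :=
        Real.log_div hN0.ne' two_ne_zero
      have hlog4 : Real.log 4 ≤ Real.log N :=
        Real.log_le_log (by norm_num) (by exact_mod_cast (show 4 ≤ N by omega))
      have hlog4' : Real.log 4 = 2 * Real.log 2 := by
        rw [show (4 : ℝ) = 2 ^ 2 by norm_num, Real.log_pow]; push_cast; ring
      calc Real.log N / 2 ≤ Real.log N - Real.log 2 := by linarith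
        _ = Real.log ((N : ℝ) / 2) := hlog2.symm
        _ ≤ Real.log n₃ := Real.log_le_log (by positivity) hn₃
  have h2 : ∑ n₃ ∈ range (N + 1), (hbRep c N n₃ : ℝ) = primePairCount (hbX N) (hbEta c N) := by
    exact_mod_cast sum_hbRep_eq hη
  rw [← Finset.mul_sum, h2] at h1
  have h3 : κ * (hbEta c N ^ 2 * hbX N ^ 2 / Real.log N) ≤
      primePairCount (hbX N) (hbEta c N) :=
    le_trans (mul_le_mul_of_nonneg_left
      (div_le_div_of_nonneg_left (by positivity) hLX hLXle) hκ.le) hPP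
  have hXlo : (N : ℝ) ^ ((1 : ℝ) / 3) / 2 ≤ hbX N := by
    by_contra h
    rw [not_le] at h
    have hX0 := hbX_nonneg N
    have hlt3 : hbX N ^ 3 < ((N : ℝ) ^ ((1 : ℝ) / 3) / 2) ^ 3 := by gcongr
    rw [hbX_pow_three, div_pow, hcube] at hlt3
    norm_num at hlt3
    linarith
  have hNX : (N : ℝ) / 4 ≤ (N : ℝ) ^ ((1 : ℝ) / 3) * hbX N ^ 2 := by
    have h0 : 0 ≤ (N : ℝ) ^ ((1 : ℝ) / 3) / 2 := by positivity
    calc (N : ℝ) / 4 = ((N : ℝ) ^ ((1 : ℝ) / 3)) ^ 3 / 4 := by rw [hcube]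
      _ = (N : ℝ) ^ ((1 : ℝ) / 3) * ((N : ℝ) ^ ((1 : ℝ) / 3) / 2) ^ 2 := by ring
      _ ≤ (N : ℝ) ^ ((1 : ℝ) / 3) * hbX N ^ 2 := by gcongr
  have h4 : (N : ℝ) ^ ((1 : ℝ) / 3) * (Real.log N / 2) *
      (κ * (hbEta c N ^ 2 * hbX N ^ 2 / Real.log N)) =
      κ / 2 * hbEta c N ^ 2 * ((N : ℝ) ^ ((1 : ℝ) / 3) * hbX N ^ 2) := by
    field_simp
  calc κ / 8 * hbEta c N ^ 2 * N = κ / 2 * hbEta c N ^ 2 * ((N : ℝ) / 4) := by ring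
    _ ≤ κ / 2 * hbEta c N ^ 2 * ((N : ℝ) ^ ((1 : ℝ) / 3) * hbX N ^ 2) := by gcongr
    _ = (N : ℝ) ^ ((1 : ℝ) / 3) * (Real.log N / 2) *
          (κ * (hbEta c N ^ 2 * hbX N ^ 2 / Real.log N)) := h4.symm
    _ ≤ (N : ℝ) ^ ((1 : ℝ) / 3) * (Real.log N / 2) * primePairCount (hbX N) (hbEta c N) :=
        mul_le_mul_of_nonneg_left h3 (by positivity)
    _ ≤ _ := h1

/-- **F1 PROVED**, with `c_M = c₀ κ / 32` (`c₀ = 1/16` from E6 at scale `2N`). [this line] -/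
theorem mainTermLowerAP_holds : MainTermLowerAP := by
  intro c hc κ hκ hHB B hB
  obtain ⟨c₀, hc₀, N₆, h6⟩ := roughModelPairCountLower_holds B hB
  refine ⟨c₀ * κ / 32, by positivity, ?_⟩
  have hev1 := tendsto_hbX.eventually hHB
  have hev2 : ∀ᶠ N : ℕ in atTop, hbEta c N ≤ 1 / 10 :=
    ((tendsto_hbEta hc).eventually (gt_mem_nhds (by norm_num : (0 : ℝ) < 1 / 10))).mono
      fun N h => h.le
  obtain ⟨N₅, hN₅⟩ := Filter.eventually_atTop.1 (hev1.and (hev2.and (eventually_gt_atTop 6)))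
  refine ⟨N₅ + N₆, fun N hN => ?_⟩
  obtain ⟨hPP, hη, hN6⟩ := hN₅ N (by omega)
  change κ * (hbEta c N ^ 2 * hbX N ^ 2 / Real.log (hbX N)) ≤
    (primePairCount (hbX N) (hbEta c N) : ℝ) at hPP
  obtain ⟨hX1, hLX, hLXle⟩ := hbX_facts hN6
  have hN0 : (0 : ℝ) < N := by exact_mod_cast (show 0 < N by omega)
  have hLN : 0 < Real.log N := Real.log_pos (by exact_mod_cast (show 1 < N by omega))
  set M : ℕ := 2 * N with hMdef
  have hMR : (M : ℝ) = 2 * N := by rw [hMdef]; push_cast; ring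
  -- Step 1: regroup over `k`
  have hfib := ternarySum_ge_fibre (gWeight B M) (apWeight c N) (gWeight_nonneg B M)
    (apWeight_nonneg c N) M
  -- Step 2: E6 (at scale `M = 2N`, even `m = 2π ∈ (N, 2N]`) on each fibre with `w(k) ≠ 0`
  have hstep2 : ∑ k ∈ range (M + 1), apWeight c N k * (c₀ * N) ≤
      ∑ k ∈ range (M + 1), apWeight c N k *
        ∑ n₁ ∈ Icc 1 (M - k - 1), gWeight B M n₁ * gWeight B M (M - k - n₁) := by
    refine Finset.sum_le_sum fun k hk => ?_
    by_cases hw : apWeight c N k = 0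
    · simp [hw]
    · refine mul_le_mul_of_nonneg_left ?_ (apWeight_nonneg c N k)
      rw [mem_range] at hk
      obtain ⟨hke, hr⟩ := apWeight_ne_zero hw
      obtain ⟨x, y, hx, hy, hp, hval, hlt⟩ := exists_of_hbRep_ne_zero hr
      have hke' : k % 2 = 0 := Nat.even_iff.1 hke
      have hmk : M - k = 2 * (N - k / 2) := by omega
      have hm_even : Even (M - k) := ⟨N - k / 2, by omega⟩
      have hm_lo : (M : ℝ) / 4 ≤ ((M - k : ℕ) : ℝ) := by
        have h' : N < M - k := by omega
        have h'' : (N : ℝ) < ((M - k : ℕ) : ℝ) := by exact_mod_cast h'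
        rw [hMR]; linarith
      have h6m := h6 M (by omega) (M - k) hm_even hm_lo (Nat.sub_le M k)
      have hsum : ∑ n ∈ Icc 1 (M - k - 1), roughModel B M n * roughModel B M (M - k - n) =
          ∑ n₁ ∈ Icc 1 (M - k - 1), gWeight B M n₁ * gWeight B M (M - k - n₁) := by
        refine Finset.sum_congr rfl fun n₁ hn₁ => ?_
        rw [mem_Icc] at hn₁
        have h1 : n₁ ∈ Icc 1 M := by rw [mem_Icc]; omega
        have h2 : M - k - n₁ ∈ Icc 1 M := by rw [mem_Icc]; omega
        simp only [gWeight, if_pos h1, if_pos h2]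
      have hNm : (N : ℝ) ≤ ((M - k : ℕ) : ℝ) := by
        exact_mod_cast (show N ≤ M - k by omega)
      calc c₀ * N ≤ c₀ * ((M - k : ℕ) : ℝ) := mul_le_mul_of_nonneg_left hNm hc₀.le
        _ ≤ _ := by rw [← hsum]; exact h6m
  -- Step 3: the mass `∑ w = ∑ f₃ ≥ (κ/8) η² N`
  have hmass : κ / 8 * hbEta c N ^ 2 * N ≤ ∑ k ∈ range (M + 1), apWeight c N k := by
    rw [hMdef, sum_apWeight_eq]
    exact mass_ge hκ hN6 hη hPP
  -- Step 4: `(log M)^{-2c} ≤ (log N)^{-2c} ≤ η²`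
  have hLM : Real.log N ≤ Real.log M := by
    rw [hMR]; exact Real.log_le_log hN0 (by linarith)
  have hη2 : Real.log (M : ℝ) ^ (-(2 * c)) ≤ hbEta c N ^ 2 :=
    (Real.rpow_le_rpow_of_nonpos hLN hLM (by linarith)).trans (log_rpow_neg_le_hbEta_sq hc.le hN6)
  -- Step 5: combine
  have hfinal : ∑ k ∈ range (M + 1), apWeight c N k * (c₀ * N) =
      (c₀ * N) * ∑ k ∈ range (M + 1), apWeight c N k := by
    rw [Finset.mul_sum]; exact Finset.sum_congr rfl fun _ _ => mul_comm _ _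
  have hM2 : (M : ℝ) ^ 2 = 4 * (N : ℝ) ^ 2 := by rw [hMR]; ring
  calc c₀ * κ / 32 * Real.log (M : ℝ) ^ (-(2 * c)) * (M : ℝ) ^ 2
      = (c₀ * N / 4) * (κ / 2 * Real.log (M : ℝ) ^ (-(2 * c)) * N) := by rw [hM2]; ring
    _ ≤ (c₀ * N / 4) * (κ / 2 * hbEta c N ^ 2 * N) := by gcongr
    _ = (c₀ * N) * (κ / 8 * hbEta c N ^ 2 * N) := by ring
    _ ≤ (c₀ * N) * ∑ k ∈ range (M + 1), apWeight c N k :=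
        mul_le_mul_of_nonneg_left hmass (by positivity)
    _ = ∑ k ∈ range (M + 1), apWeight c N k * (c₀ * N) := hfinal.symm
    _ ≤ _ := hstep2
    _ ≤ _ := hfib

end F1proof

end Summit.Parity.GeneralizedHardyLittlewood.Theses.HeathBrownPrimeAP3

end
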